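/-
Copyright (c) 2026. All rights reserved.
Released under Apache 2.0 license as described in the file LICENSE.
-/
import Literature.NumberTheory.QuadraticFields.GaussThreeSquaresClassNumber
import Literature.NumberTheory.QuadraticFields.ClassNumberOneGenus
import Literature.NumberTheory.Waring.ThreeSquaresPrimitiveCount
import HarnessLib

/-!
# Gauss's three-squares theorem with class numbers holds: `Gauss_threeSquaresPrim_classNumber_holds`

[tag: class_number] [tag: sum_of_squares] [tag: binary_quadratic_form]

Topic `NumberTheory/QuadraticFields`; THEOREMS ONLY (no definition, no named fact, no instance). This file DISCHARGES
the named fact `Gauss_threeSquaresPrim_classNumber` of `GaussThreeSquaresClassNumber.lean` (Voight, *Quaternion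
Algebras*, Thm. 30.1.3; Gauss, *Disquisitiones* Art. 291):

> for `n ≡ 1, 2, 5, 6 (mod 8)`, `n ≠ 1`: `r₃^prim(n) = 12·h(−4n)`; for `n ≡ 3 (mod 8)`, `n ≠ 3`: `r₃^prim(n) = 24·h(−n)`,

`h(d) = BinQF.classNumber d` the number of reduced primitive positive definite binary quadratic forms of discriminant
`d`. The proof is the tree's quaternionic count of PRIMITIVE representations (`Waring/ThreeSquaresPrimitiveCount`,
Grosswald Ch. 4 §8 Thm. 2: `R₃(n) = 24·h(−n)` for `n ≡ 3 (mod 8)`, `n > 3`, and `R₃(n) = 12·h(−4n)` for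
`n ≡ 1, 2 (mod 4)`, `n > 1`, there with `h = BinaryQuadraticForm.classNumber` of `ReducedForms.lean`), the
identification of the two reduced-form counts of the tree (`BinaryQuadraticForm.binQF_classNumber_eq`,
`ClassNumberOneGenus.lean`), and the identification of Voight's box count `threeSquareRepsPrim n` with the `Nat.card` of
the primitive solution set (`threeSquareRepsPrim_eq_natCard`).

* §1 `threeSquareReps_eq_natCard`, `threeSquareRepsPrim_eq_natCard` (the finset counts of `GaussThreeSquaresClassNumber`
  are the `Nat.card`s of the `Waring` files), **`threeSquareReps_eq_hurwitz`** (`r₃(n) = 12(H(4n) − 2H(n))` for Voight's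
  `threeSquareReps`, from `ThreeSquaresCount.card_eq`);
* §2 **`threeSquareRepsPrim_eq_of_mod_four`** (`n ≡ 1, 2 (mod 4)`, `n ≠ 1`: `r₃^prim(n) = 12·h(−4n)`),
  **`threeSquareRepsPrim_eq_of_mod_eight_eq_three`** (`n ≡ 3 (mod 8)`, `n ≠ 3`: `r₃^prim(n) = 24·h(−n)`),
  **`Gauss_threeSquaresPrim_classNumber_holds`** (THE NAMED FACT), `Gauss_threeSquaresPrim_prime_cases`
  (the requester's corollary, now unconditional);
* §3 the printed middle term: **`classNumber_neg_four_mul_of_mod_eight_eq_three`** (`h(−4n) = 3·h(−n)` for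
  `n ≡ 3 (mod 8)`, `n ≠ 3` — the class number of the order of conductor `2`, Cox Cor. 7.28, `(−n∕2) = −1`),
  **`threeSquareRepsPrim_eq_eight_mul_of_mod_eight_eq_three`** (`r₃^prim(n) = 8·h(−4n)`), so that the third clause of
  Voight's Thm. 30.1.3 now stands in the tree exactly as printed: `r₃^prim(n) = 8 h(−4n) = 24 h(−n)`.

## Sources

* J. Voight, *Quaternion Algebras*, GTM 288 (2021), Thm. 30.1.3 and §30.4 (Thm. 30.4.7). [cite: Voight2021, Thm 30.1.3]
* C. F. Gauss, *Disquisitiones Arithmeticae* (1801), Art. 291. [cite: Gauss1801, Art. 291]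
* E. Grosswald, *Representations of Integers as Sums of Squares* (1985), Ch. 4 §8 Thm. 2. [cite: Grosswald1985, Ch. 4 §8 Thm. 2]
* D. A. Cox, *Primes of the form x² + ny²*, 2nd ed. (2013), §2.A Thm. 2.13 (reduced forms), §7.D Thm. 7.24 and Cor. 7.28
  (`h(m²D) = h(D)·m·∏_{p∣m}(1 − (D∕p)p⁻¹)·[units]`, through the tree's `weightedClassNumber_mul_sq`). [cite: Cox2013, §2.A Thm. 2.13; §7.D Cor. 7.28]

## Scope (honest)

Theorems only; net Literature debt `−1` (one named fact discharged, none introduced). The printed middle term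
`8·h(−4n)` of the third clause (`h(−4n) = 3h(−n)` for `n ≡ 3 (mod 8)`, `n > 3`) is not part of the fact; it is proved in §3.
-/

open Finset

namespace Literature.NumberTheory.QuadraticFields.ThreeSquares

open Literature.NumberTheory.QuadraticFields.Quadratic
open Literature.NumberTheory.Waring

/-! ## §1 The box counts are the `Nat.card`s -/

/-- `threeSquareReps n = #{y ∈ ℤ³ : Σ yᵢ² = n}` as a `Nat.card`. [cite: Voight2021, §30.1] -/
theorem threeSquareReps_eq_natCard (n : ℕ) :
    threeSquareReps n = Nat.card {y : ℤ × ℤ × ℤ // y.1 ^ 2 + y.2.1 ^ 2 + y.2.2 ^ 2 = (n : ℤ)} := by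
  rw [threeSquareReps, ← Nat.card_eq_finsetCard]
  exact Nat.card_congr (Equiv.subtypeEquivRight fun v => mem_filter_threeSquare_iff)

/-- `threeSquareRepsPrim n = #{y ∈ ℤ³ : Σ yᵢ² = n, gcd = 1}` as a `Nat.card`. [cite: Voight2021, eq. (30.1.2)] -/
theorem threeSquareRepsPrim_eq_natCard (n : ℕ) :
    threeSquareRepsPrim n =
      Nat.card {y : ℤ × ℤ × ℤ // y.1 ^ 2 + y.2.1 ^ 2 + y.2.2 ^ 2 = (n : ℤ) ∧ Int.gcd (Int.gcd y.1 y.2.1) y.2.2 = 1} := by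
  rw [threeSquareRepsPrim, ← Nat.card_eq_finsetCard]
  exact Nat.card_congr (Equiv.subtypeEquivRight fun v => mem_filter_threeSquarePrim_iff)

/-- **Gauss's count for Voight's `r₃`: `r₃(n) = 12·(H(4n) − 2H(n))`** (the tree's `ThreeSquaresCount.card_eq`).
[cite: Voight2021, Thm 30.1.3] [cite: Grosswald1985, Ch. 4 §8 Thm. 2] -/
theorem threeSquareReps_eq_hurwitz (n : ℕ) :
    (threeSquareReps n : ℚ) = 12 * (hurwitzClassNumber (4 * n) - 2 * hurwitzClassNumber n) := by
  rw [threeSquareReps_eq_natCard]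
  exact ThreeSquaresCount.card_eq n

/-! ## §2 The class-number clauses -/

/-- **`r₃^prim(n) = 12·h(−4n)` for `n ≡ 1, 2 (mod 4)`, `n ≠ 1`** (`h = BinQF.classNumber`). [cite: Voight2021, Thm 30.1.3] [cite: Grosswald1985, Ch. 4 §8 Thm. 2] -/
theorem threeSquareRepsPrim_eq_of_mod_four {n : ℕ} (h : n % 4 = 1 ∨ n % 4 = 2) (hn : n ≠ 1) :
    threeSquareRepsPrim n = 12 * BinQF.classNumber (-4 * (n : ℤ)) := by
  have key := ThreeSquaresPrimitiveCount.card_primitive_eq_classNumber_of_mod_four h (by omega)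
  rw [threeSquareRepsPrim_eq_natCard, BinaryQuadraticForm.binQF_classNumber_eq _ (by omega), neg_mul]
  exact_mod_cast key

/-- **`r₃^prim(n) = 24·h(−n)` for `n ≡ 3 (mod 8)`, `n ≠ 3`** (`h = BinQF.classNumber`). [cite: Voight2021, Thm 30.1.3] [cite: Grosswald1985, Ch. 4 §8 Thm. 2] -/
theorem threeSquareRepsPrim_eq_of_mod_eight_eq_three {n : ℕ} (h : n % 8 = 3) (hn : n ≠ 3) :
    threeSquareRepsPrim n = 24 * BinQF.classNumber (-(n : ℤ)) := by
  have key := ThreeSquaresPrimitiveCount.card_primitive_eq_classNumber_of_mod_eight_eq_three h (by omega)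
  rw [threeSquareRepsPrim_eq_natCard, BinaryQuadraticForm.binQF_classNumber_eq _ (by omega)]
  exact_mod_cast key

/-- **GAUSS'S THREE-SQUARES THEOREM WITH CLASS NUMBERS HOLDS** — the named fact `Gauss_threeSquaresPrim_classNumber`
(Voight Thm. 30.1.3, the two class-number clauses), discharged. [cite: Voight2021, Thm 30.1.3] [cite: Gauss1801, Art. 291] -/
theorem Gauss_threeSquaresPrim_classNumber_holds : Gauss_threeSquaresPrim_classNumber := fun _ =>
  ⟨fun h8 hn => threeSquareRepsPrim_eq_of_mod_four (by omega) hn,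
    fun h8 hn => threeSquareRepsPrim_eq_of_mod_eight_eq_three h8 hn⟩

/-- The requester's corollary (`Q ≥ 5`), now unconditional: `Q ≡ 3 (mod 8) ⟹ r₃^prim(Q) = 24 h(−Q)`,
`Q ≡ 1 (mod 4) ⟹ r₃^prim(Q) = 12 h(−4Q)`, `Q ≡ 7 (mod 8) ⟹ r₃^prim(Q) = 0`. [cite: Voight2021, Thm 30.1.3] -/
theorem Gauss_threeSquaresPrim_prime_cases {Q : ℕ} (h5 : 5 ≤ Q) :
    (Q % 8 = 3 → threeSquareRepsPrim Q = 24 * BinQF.classNumber (-(Q : ℤ))) ∧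
    (Q % 4 = 1 → threeSquareRepsPrim Q = 12 * BinQF.classNumber (-4 * (Q : ℤ))) ∧
    (Q % 8 = 7 → threeSquareRepsPrim Q = 0) :=
  Gauss_threeSquaresPrim_classNumber.prime_cases Gauss_threeSquaresPrim_classNumber_holds h5

/-! ## §3 The printed middle term: `h(−4n) = 3·h(−n)` and `r₃^prim(n) = 8·h(−4n)` for `n ≡ 3 (mod 8)` -/

/-- **`h(−4n) = 3·h(−n)` for `n ≡ 3 (mod 8)`, `n ≠ 3`** (the order of conductor `2` in `ℚ(√−n)`: `h(4D) = h(D)·2·(1 − (D∕2)/2)`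
with `(D∕2) = −1` for `D = −n ≡ 5 (mod 8)`, no unit correction since `D < −4`). [cite: Cox2013, §7.D Cor. 7.28] [cite: Voight2021, Thm 30.1.3] -/
theorem classNumber_neg_four_mul_of_mod_eight_eq_three {n : ℕ} (h : n % 8 = 3) (hn : n ≠ 3) :
    BinQF.classNumber (-4 * (n : ℤ)) = 3 * BinQF.classNumber (-(n : ℤ)) := by
  have hD : (-(n : ℤ)) < 0 := by omega
  have hD4 : (-4 * (n : ℤ)) < 0 := by omega
  have key := weightedClassNumber_mul_sq hD (Or.inr (by omega)) (m := 2) two_ne_zero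
  rw [Nat.Prime.primeFactors Nat.prime_two, prod_singleton, if_pos rfl, if_neg (by omega), if_pos (by omega),
    show ((2 : ℕ) : ℤ) ^ 2 * -(n : ℤ) = -4 * (n : ℤ) by ring, ← hurwitzWeight_mul_classNumber hD4,
    ← hurwitzWeight_mul_classNumber hD] at key
  unfold hurwitzWeight at key
  rw [if_neg (by omega), if_neg (by omega), if_neg (by omega), if_neg (by omega), one_mul, one_mul] at key
  rw [BinaryQuadraticForm.binQF_classNumber_eq _ hD4, BinaryQuadraticForm.binQF_classNumber_eq _ hD]
  have key' : ((BinaryQuadraticForm.classNumber (-4 * (n : ℤ)) : ℚ) =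
      3 * BinaryQuadraticForm.classNumber (-(n : ℤ))) := by
    rw [key]
    push_cast
    ring
  exact_mod_cast key'

/-- **`r₃^prim(n) = 8·h(−4n)` for `n ≡ 3 (mod 8)`, `n ≠ 3`** — the middle term of Voight's third clause
`r₃^prim(n) = 8 h(−4n) = 24 h(−n)`. [cite: Voight2021, Thm 30.1.3] [cite: Grosswald1985, Ch. 4 §8 Thm. 2] -/
theorem threeSquareRepsPrim_eq_eight_mul_of_mod_eight_eq_three {n : ℕ} (h : n % 8 = 3) (hn : n ≠ 3) :
    threeSquareRepsPrim n = 8 * BinQF.classNumber (-4 * (n : ℤ)) := by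
  rw [classNumber_neg_four_mul_of_mod_eight_eq_three h hn, threeSquareRepsPrim_eq_of_mod_eight_eq_three h hn]
  ring

/-- Voight's Thm. 30.1.3, third clause, as printed: `n ≡ 3 (mod 8)`, `n ≠ 3` ⟹ `r₃^prim(n) = 8 h(−4n)` and `= 24 h(−n)`.
[cite: Voight2021, Thm 30.1.3] -/
theorem threeSquareRepsPrim_of_mod_eight_eq_three {n : ℕ} (h : n % 8 = 3) (hn : n ≠ 3) :
    threeSquareRepsPrim n = 8 * BinQF.classNumber (-4 * (n : ℤ)) ∧
      threeSquareRepsPrim n = 24 * BinQF.classNumber (-(n : ℤ)) :=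
  ⟨threeSquareRepsPrim_eq_eight_mul_of_mod_eight_eq_three h hn, threeSquareRepsPrim_eq_of_mod_eight_eq_three h hn⟩

end Literature.NumberTheory.QuadraticFields.ThreeSquares
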